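import Summits.Ventures.HodgeRepro2.KunnethProjector

/-!
# KunnethModel — the Künneth decomposition holds in the exterior-algebra model (Tier 4, T4-A)

Seat p3 of the blind cell `pub-hodge-repro2` (Tier 4, README §6).  Imports `KunnethProjector`.

`KunnethProjector.lean` takes the Künneth decomposition of `H^*(A, ℚ)` under `[n]^*` as a named
Prop (`IsKunnethDecomposition`).  This file DISCHARGES it in the model of TIER4.md §A0 for the
cohomology of a complex torus (Lange 2023 Prop. 1.1.20 / Thm. 1.1.21, [C] in TIER4): with
`V = H¹(A, ℚ)`, `H^k(A, ℚ) = ⋀^k V` and `[n]^* = n · id` on `H¹`, the induced map on `⋀^k V` is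
`⋀^k(n · id) = n^k · id` (`map_scaleMap_apply`: on the spanning decomposable vectors
`v₁ ∧ ⋯ ∧ v_k` by multilinearity, then by linearity), so on the total cohomology
`⨁_{k ≤ d} ⋀^k V` the operator `N := ⨁_k ⋀^k(n · id)` has every vector as a sum of
`n^k`-eigenvectors (`isKunnethDecomposition_totalMap`).  Consequently the Lagrange
polynomial `P_k(N)` of `KunnethProjector` is the projector onto the `k`-th summand: it is the
identity on `⋀^k V`, zero on the other summands (`kunnethOperator_totalMap_lof`), and its range
is exactly the image of `⋀^k V` (`range_kunnethOperator_totalMap`).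

Axioms: propext, Classical.choice, Quot.sound.
-/

namespace Summit.Ventures.HodgeRepro2.KunnethModel

open Module DirectSum
open Summit.Ventures.HodgeRepro2.KunnethProjector

variable {V : Type*} [AddCommGroup V] [Module ℚ V]

/-- `[n]^*` on `H¹`: multiplication by `n`. -/
def scaleMap (n : ℕ) : V →ₗ[ℚ] V := (n : ℚ) • LinearMap.id

/-- `scaleMap n` composed with a family is the pointwise scaling. -/
theorem scaleMap_comp (n : ℕ) {k : ℕ} (m : Fin k → V) :
    scaleMap n ∘ m = fun i => (n : ℚ) • m i := by
  funext i
  simp [scaleMap]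

/-- `⋀^k(n · id) = n^k · id` on `⋀^k V`. -/
theorem map_scaleMap_apply (n k : ℕ) (x : ⋀[ℚ]^k V) :
    exteriorPower.map k (scaleMap n) x = ((n : ℚ) ^ k) • x := by
  have hx : x ∈ Submodule.span ℚ (Set.range (exteriorPower.ιMulti ℚ k (M := V))) := by
    rw [exteriorPower.ιMulti_span]
    exact Submodule.mem_top
  induction hx using Submodule.span_induction with
  | mem y hy =>
    obtain ⟨m, rfl⟩ := hy
    rw [exteriorPower.map_apply_ιMulti, scaleMap_comp, AlternatingMap.map_smul_univ]
    simp
  | zero => simp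
  | add y z _ _ hy hz => rw [map_add, hy, hz, smul_add]
  | smul c y _ hy => rw [map_smul, hy, smul_comm]

/-- The total cohomology of the model: `⨁_{k ≤ d} ⋀^k V` (`d = 2g`). -/
abbrev Total (V : Type*) [AddCommGroup V] [Module ℚ V] (d : ℕ) : Type _ :=
  ⨁ (k : Fin (d + 1)), ⋀[ℚ]^(k : ℕ) V

/-- The operator `[n]^*` on the total cohomology: `⨁_k ⋀^k(n · id)`. -/
noncomputable def totalMap (n d : ℕ) : Total V d →ₗ[ℚ] Total V d :=
  DirectSum.lmap fun k : Fin (d + 1) => exteriorPower.map (k : ℕ) (scaleMap n)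

/-- `[n]^*` acts on the `k`-th summand by `n^k`. -/
theorem totalMap_lof (n d : ℕ) (k : Fin (d + 1)) (x : ⋀[ℚ]^(k : ℕ) V) :
    totalMap n d (lof ℚ (Fin (d + 1)) (fun k : Fin (d + 1) => ⋀[ℚ]^(k : ℕ) V) k x) =
      node n k • lof ℚ (Fin (d + 1)) (fun k : Fin (d + 1) => ⋀[ℚ]^(k : ℕ) V) k x := by
  unfold totalMap
  rw [DirectSum.lmap_lof, map_scaleMap_apply, map_smul]
  rfl

/-- THE KÜNNETH DECOMPOSITION HOLDS IN THE MODEL: every vector of the total cohomology is a sum of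
`n^k`-eigenvectors of `[n]^*`, `k ≤ d`. -/
theorem isKunnethDecomposition_totalMap (n d : ℕ) :
    IsKunnethDecomposition (V := Total V d) (totalMap (V := V) n d) n d := by
  classical
  intro v
  refine ⟨fun j => if h : j < d + 1 then
    lof ℚ (Fin (d + 1)) (fun k : Fin (d + 1) => ⋀[ℚ]^(k : ℕ) V) ⟨j, h⟩ (v ⟨j, h⟩) else 0,
    ?_, ?_⟩
  · intro j hj
    have h : j < d + 1 := by omega
    simp only [dif_pos h]
    exact totalMap_lof n d ⟨j, h⟩ (v ⟨j, h⟩)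
  · rw [← Fin.sum_univ_eq_sum_range]
    simp only [Fin.is_lt, dif_pos, Fin.eta]
    conv_lhs => rw [← DirectSum.sum_univ_of v]
    exact Finset.sum_congr rfl fun i _ =>
      (DirectSum.lof_eq_of ℚ (Fin (d + 1)) (fun k : Fin (d + 1) => ⋀[ℚ]^(k : ℕ) V) i (v i)).symm

/-- The Künneth operator `P_k([n]^*)` of `KunnethProjector` is the identity on the `k`-th summand
`⋀^k V` and zero on the other summands (`n ⩾ 2`). -/
theorem kunnethOperator_totalMap_lof {n : ℕ} (hn : 2 ≤ n) (d : ℕ) (k j : Fin (d + 1))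
    (y : ⋀[ℚ]^(j : ℕ) V) :
    kunnethOperator (V := Total V d) (totalMap (V := V) n d) n d k
        (lof ℚ (Fin (d + 1)) (fun k : Fin (d + 1) => ⋀[ℚ]^(k : ℕ) V) j y) =
      if (j : ℕ) = k then lof ℚ (Fin (d + 1)) (fun k : Fin (d + 1) => ⋀[ℚ]^(k : ℕ) V) j y
      else 0 :=
  kunnethOperator_apply_of_apply_eq_smul _ hn (Nat.lt_succ_iff.mp k.isLt)
    (Nat.lt_succ_iff.mp j.isLt) (totalMap_lof n d j y)

/-- In the model, the range of the Künneth operator `P_k([n]^*)` is the `k`-th summand `⋀^k V`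
— the projector onto `H^k(A, ℚ)`. -/
theorem range_kunnethOperator_totalMap {n : ℕ} (hn : 2 ≤ n) (d : ℕ) (k : Fin (d + 1)) :
    LinearMap.range (kunnethOperator (V := Total V d) (totalMap (V := V) n d) n d k) =
      LinearMap.range (lof ℚ (Fin (d + 1)) (fun k : Fin (d + 1) => ⋀[ℚ]^(k : ℕ) V) k) := by
  classical
  ext x
  constructor
  · rintro ⟨w, rfl⟩
    refine ⟨w k, ?_⟩
    symm
    conv_lhs => rw [← DirectSum.sum_univ_of w]
    rw [map_sum, Finset.sum_eq_single k]
    · rw [← DirectSum.lof_eq_of ℚ (Fin (d + 1)) (fun k : Fin (d + 1) => ⋀[ℚ]^(k : ℕ) V),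
        kunnethOperator_totalMap_lof hn d k k, if_pos rfl]
    · intro j _ hjk
      rw [← DirectSum.lof_eq_of ℚ (Fin (d + 1)) (fun k : Fin (d + 1) => ⋀[ℚ]^(k : ℕ) V),
        kunnethOperator_totalMap_lof hn d k j, if_neg (fun h => hjk (Fin.ext h))]
    · intro h
      exact absurd (Finset.mem_univ k) h
  · rintro ⟨y, rfl⟩
    refine ⟨lof ℚ (Fin (d + 1)) (fun k : Fin (d + 1) => ⋀[ℚ]^(k : ℕ) V) k y, ?_⟩
    rw [kunnethOperator_totalMap_lof hn d k k, if_pos rfl]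

end Summit.Ventures.HodgeRepro2.KunnethModel
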